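import Mathlib.MeasureTheory.Integral.IntervalIntegral.Periodic
import Literature.Analysis.FluidPDE.PeriodicLeraySystem
import Literature.Analysis.FluidPDE.SimilarityVariables
import HarnessLib

/-!
# [BT1] §4 ¶1–3, the transport of suitable periodic weak solutions, I: the ansatz in the
  similarity toolkit, the energy bound and the pressure class

Analysis/FluidPDE proof file (theorems only), first part of the discharge of the named fact
`Literature.Analysis.FluidPDE.bradshawTsai2017_ansatz_transport` (`PeriodicLeraySystem.lean`;
Bradshaw–Tsai, Ann. Henri Poincaré 18 (2017) = arXiv:1510.07504 [BT1], §4, proof of Thm 1.2,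
¶1–3): the ansatz `v(x,t) = u(y,s)/√(2t)`, `π(x,t) = p(y,s)/(2t)` (`BradshawTsai2017.physVelocity`,
`physPressure`) maps a suitable periodic weak solution of the time-periodic Leray system
(`BradshawTsai2017.IsSuitablePeriodicWeakSolution`, period `T = log λ`) to an ansatz pair
(`BradshawTsai2017.IsAnsatzSolution λ v₀ v π`, `ForwardDSSLocalLeray.lean`). With the toolkit
`SimilarityVariables` (`Φ(s,y) = (e^{2s}/2, eˢy)`, `Φ_*(e^{5s} ds dy) = dt dx` on `ℝ³`), this file
proves:

* the ansatz read through `Φ`: `v(Φ(s,y)) = e^{-s} u(s,y)`, `π(Φ(s,y)) = e^{-2s} p(s,y)`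
  (`physVelocity_simMap`, `physPressure_simMap`), `Φ⁻¹` of a time window
  (`preimage_simMap_Ioo_prod`, `simTimeInv_sq_mul`: the window `(1, λ²)` is one period
  `(σ(1), σ(1) + log λ)` long), the slice scaling `∫ |v(t)|² dx = √(2t) ∫ |u(s)|² dy`
  (`lintegral_enorm_sq_physVelocity`);
* **integrals of periodic space–time fields over one period do not depend on the period window**
  (`setLIntegral_Ioc_add_eq_of_periodic`, from Mathlib's fundamental-domain lemma for
  `ℤT ↷ ℝ`; `setLIntegral_Ioc_prod_eq_of_periodic`, `setLIntegral_Ioo_prod_eq_of_periodic` on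
  `ℝ × E` by Tonelli);
* the clause `IsAnsatzSolution.energy_sub_heat`: "`v − e^{tΔ}v₀ ∈ L^∞(1,λ²;L²(ℝ³))`" with the
  bound for every `t ∈ [1, λ²]` (`IsSuitablePeriodicWeakSolution.energy_sub_heat_phys`), from
  `u − U₀ ∈ L^∞(L²)` and `v − e^{tΔ}v₀ = (u − U₀)(y,s)/√(2t)`;
* the clause `IsAnsatzSolution.pressure_five_thirds`: `π ∈ L^{5/3}((1,λ²) × ℝ³)`
  (`IsSuitablePeriodicWeakSolution.pressure_five_thirds_phys`), from `p ∈ L^{5/3}(ℝ³ × [0,T])`: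
  `∫∫ |π|^{5/3} dx dt = ∫∫ e^{5s} e^{-10s/3} |p|^{5/3} dy ds` over the shifted period, which by
  periodicity of `p` is the integral over `(0, T)`.

The remaining clauses (the weak gradient with its `L²` bound, and suitability) are the subject of
the sibling files; `bradshawTsai2017_ansatz_transport_holds` is assembled there.

## References

* Z. Bradshaw, T.-P. Tsai, Ann. Henri Poincaré 18 (2017) = arXiv:1510.07504, (1.6)–(1.7), §4
  (proof of Thm 1.2) [BradshawTsai2017AHP].
-/

noncomputable section

open MeasureTheory TopologicalSpace Set Function Filter Topology Module Metric
open scoped InnerProductSpace RealInnerProductSpace ENNReal NNReal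

namespace Literature.Analysis.FluidPDE

/-! ### Integrals of periodic fields over one period -/

section Periodic

variable {E : Type*} [NormedAddCommGroup E] [InnerProductSpace ℝ E] [FiniteDimensional ℝ E]
  [MeasurableSpace E] [BorelSpace E]

omit [FiniteDimensional ℝ E] [MeasurableSpace E] [BorelSpace E] in
/-- **The lower integral of a `T`-periodic function over a period window `(t, t+T]` does not depend
on `t`** (the windows are fundamental domains of `ℤT ↷ ℝ`; the `∫⁻` analogue of Mathlib's
`Function.Periodic.intervalIntegral_add_eq`). [folklore] -/
theorem setLIntegral_Ioc_add_eq_of_periodic {f : ℝ → ℝ≥0∞} {T : ℝ} (hf : Function.Periodic f T)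
    (hT : 0 < T) (t s : ℝ) : ∫⁻ x in Ioc t (t + T), f x = ∫⁻ x in Ioc s (s + T), f x := by
  haveI : VAddInvariantMeasure (AddSubgroup.zmultiples T) ℝ volume :=
    ⟨fun c s _ => measure_preimage_add _ _ _⟩
  exact (isAddFundamentalDomain_Ioc hT t).setLIntegral_eq (isAddFundamentalDomain_Ioc hT s) f
    hf.map_vadd_zmultiples

/-- Lower integrals over `(a, b] × E` as iterated integrals (Tonelli). [folklore] -/
theorem setLIntegral_Ioc_prod_univ_eq_lintegral_lintegral {f : ℝ × E → ℝ≥0∞}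
    (hf : AEMeasurable f volume) (a b : ℝ) :
    ∫⁻ z in Ioc a b ×ˢ (univ : Set E), f z = ∫⁻ s in Ioc a b, ∫⁻ y, f (s, y) := by
  have hf' : AEMeasurable f (((volume : Measure ℝ).restrict (Ioc a b)).prod (volume : Measure E)) := by
    refine hf.mono_measure ?_
    calc ((volume : Measure ℝ).restrict (Ioc a b)).prod (volume : Measure E)
        = (volume.restrict (Ioc a b)).prod (volume.restrict univ) := by rw [Measure.restrict_univ]
      _ = (volume.prod volume).restrict (Ioc a b ×ˢ univ) := Measure.prod_restrict _ _
      _ ≤ volume.prod volume := Measure.restrict_le_self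
      _ = volume := (Measure.volume_eq_prod (ℝ) E).symm
  rw [Measure.volume_eq_prod, ← Measure.prod_restrict, Measure.restrict_univ, lintegral_prod _ hf']

/-- **Space–time fields periodic in time: the integral over a period window `(a, a+T] × E` does
not depend on `a`.** [folklore] -/
theorem setLIntegral_Ioc_prod_eq_of_periodic {f : ℝ × E → ℝ≥0∞} (hf : AEMeasurable f volume)
    {T : ℝ} (hT : 0 < T) (hper : ∀ s y, f (s + T, y) = f (s, y)) (a b : ℝ) :
    ∫⁻ z in Ioc a (a + T) ×ˢ (univ : Set E), f z = ∫⁻ z in Ioc b (b + T) ×ˢ (univ : Set E), f z := by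
  rw [setLIntegral_Ioc_prod_univ_eq_lintegral_lintegral hf,
    setLIntegral_Ioc_prod_univ_eq_lintegral_lintegral hf]
  have hper' : Function.Periodic (fun s => ∫⁻ y, f (s, y)) T := fun s => by
    simp only [hper]
  exact setLIntegral_Ioc_add_eq_of_periodic hper' hT a b

/-- The same for open windows `(a, a+T) × E` (they differ from `(a, a+T] × E` by a null set). [folklore] -/
theorem setLIntegral_Ioo_prod_eq_of_periodic {f : ℝ × E → ℝ≥0∞} (hf : AEMeasurable f volume)
    {T : ℝ} (hT : 0 < T) (hper : ∀ s y, f (s + T, y) = f (s, y)) (a b : ℝ) :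
    ∫⁻ z in Ioo a (a + T) ×ˢ (univ : Set E), f z = ∫⁻ z in Ioo b (b + T) ×ˢ (univ : Set E), f z := by
  have h : ∀ c : ℝ, (Ioo c (c + T) ×ˢ (univ : Set E) : Set (ℝ × E)) =ᵐ[volume]
      (Ioc c (c + T) ×ˢ (univ : Set E) : Set (ℝ × E)) := fun c => by
    rw [Measure.volume_eq_prod]
    exact Measure.set_prod_ae_eq Ioo_ae_eq_Ioc (ae_eq_refl _)
  rw [setLIntegral_congr (h a), setLIntegral_congr (h b)]
  exact setLIntegral_Ioc_prod_eq_of_periodic hf hT hper a b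

end Periodic

namespace BradshawTsai2017

/-! ### The ansatz read through the similarity toolkit -/

/-- For `t > 0` the ansatz velocity is `(√(2t))⁻¹ • u(Φ⁻¹(t, x))`. [cite: BradshawTsai2017AHP, (1.6)–(1.7)] -/
theorem physVelocity_of_pos (u : ℝ → (EuclideanSpace ℝ (Fin 3)) → (EuclideanSpace ℝ (Fin 3))) {t : ℝ} (ht : 0 < t) (x : (EuclideanSpace ℝ (Fin 3))) :
    physVelocity u t x = (Real.sqrt (2 * t))⁻¹ • u (simTimeInv t) ((Real.sqrt (2 * t))⁻¹ • x) := by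
  simp only [physVelocity, if_pos ht, simTimeInv]

/-- For `t > 0` the ansatz pressure is `(2t)⁻¹ p(Φ⁻¹(t, x))`. [cite: BradshawTsai2017AHP, §4 (proof of Thm 1.2)] -/
theorem physPressure_of_pos (p : ℝ → (EuclideanSpace ℝ (Fin 3)) → ℝ) {t : ℝ} (ht : 0 < t) (x : (EuclideanSpace ℝ (Fin 3))) :
    physPressure p t x = (2 * t)⁻¹ * p (simTimeInv t) ((Real.sqrt (2 * t))⁻¹ • x) := by
  simp only [physPressure, if_pos ht, simTimeInv]

/-- **The ansatz velocity through `Φ`**: `v(Φ(s, y)) = e^{-s} u(s, y)`. [cite: BradshawTsai2017AHP, (1.6)–(1.7)] -/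
theorem physVelocity_simMap (u : ℝ → (EuclideanSpace ℝ (Fin 3)) → (EuclideanSpace ℝ (Fin 3))) (s : ℝ) (y : (EuclideanSpace ℝ (Fin 3))) :
    physVelocity u (simTime s) (Real.exp s • y) = (Real.exp s)⁻¹ • u s y := by
  rw [physVelocity_of_pos u (simTime_pos s), sqrt_two_mul_simTime, simTimeInv_simTime, smul_smul,
    inv_mul_cancel₀ (Real.exp_pos s).ne', one_smul]

/-- **The ansatz pressure through `Φ`**: `π(Φ(s, y)) = e^{-2s} p(s, y)`. [cite: BradshawTsai2017AHP, §4 (proof of Thm 1.2)] -/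
theorem physPressure_simMap (p : ℝ → (EuclideanSpace ℝ (Fin 3)) → ℝ) (s : ℝ) (y : (EuclideanSpace ℝ (Fin 3))) :
    physPressure p (simTime s) (Real.exp s • y) = (Real.exp (2 * s))⁻¹ * p s y := by
  rw [physPressure_of_pos p (simTime_pos s), sqrt_two_mul_simTime, simTimeInv_simTime, smul_smul,
    inv_mul_cancel₀ (Real.exp_pos s).ne', one_smul, two_mul_simTime]

/-- The uncurried ansatz velocity on the slab: `v(z) = (√(2t))⁻¹ • u(Φ⁻¹ z)`, `z = (t, x)`,
`t > 0`. [cite: BradshawTsai2017AHP, (1.6)–(1.7)] -/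
theorem uncurry_physVelocity_of_pos (u : ℝ → (EuclideanSpace ℝ (Fin 3)) → (EuclideanSpace ℝ (Fin 3))) {z : ℝ × (EuclideanSpace ℝ (Fin 3))} (hz : 0 < z.1) :
    uncurry (physVelocity u) z = (Real.sqrt (2 * z.1))⁻¹ • uncurry u (simInv z) := by
  obtain ⟨t, x⟩ := z
  exact physVelocity_of_pos u hz x

/-- The uncurried ansatz pressure on the slab: `π(z) = (2t)⁻¹ p(Φ⁻¹ z)`. [cite: BradshawTsai2017AHP, §4 (proof of Thm 1.2)] -/
theorem uncurry_physPressure_of_pos (p : ℝ → (EuclideanSpace ℝ (Fin 3)) → ℝ) {z : ℝ × (EuclideanSpace ℝ (Fin 3))} (hz : 0 < z.1) :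
    uncurry (physPressure p) z = (2 * z.1)⁻¹ * uncurry p (simInv z) := by
  obtain ⟨t, x⟩ := z
  exact physPressure_of_pos p hz x

/-- The ansatz is linear: `physVelocity (u − U₀) = physVelocity u − physVelocity U₀`. [folklore] -/
theorem physVelocity_sub (u U₀ : ℝ → (EuclideanSpace ℝ (Fin 3)) → (EuclideanSpace ℝ (Fin 3))) (t : ℝ) (x : (EuclideanSpace ℝ (Fin 3))) :
    physVelocity (fun s y => u s y - U₀ s y) t x = physVelocity u t x - physVelocity U₀ t x := by
  by_cases ht : 0 < t
  · simp only [physVelocity, if_pos ht, smul_sub]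
  · simp only [physVelocity, if_neg ht, sub_zero]

/-- `v − e^{tΔ}v₀` is the ansatz image of `u − U₀`, `U₀ = similarityProfile v₀`, for `t > 0`. [cite: BradshawTsai2017AHP, §4 (proof of Thm 1.2)] -/
theorem physVelocity_sub_heatExtension_eq (u : ℝ → (EuclideanSpace ℝ (Fin 3)) → (EuclideanSpace ℝ (Fin 3))) (v₀ : (EuclideanSpace ℝ (Fin 3)) → (EuclideanSpace ℝ (Fin 3))) {t : ℝ} (ht : 0 < t)
    (x : (EuclideanSpace ℝ (Fin 3))) :
    physVelocity u t x - UnboundedOperators.heatExtension v₀ t x =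
      physVelocity (fun s y => u s y - similarityProfile v₀ s y) t x := by
  rw [physVelocity_sub, physVelocity_similarityProfile v₀ ht]

/-- The Jacobian of `Φ` on `ℝ × ℝ³` is `e^{5s}`. [folklore] -/
theorem coe_simDensity_three (z : ℝ × (EuclideanSpace ℝ (Fin 3))) : (simDensity (EuclideanSpace ℝ (Fin 3)) z : ℝ) = Real.exp (5 * z.1) := by
  rw [coe_simDensity, finrank_euclideanSpace_fin]
  norm_num

/-- `σ(λ² t) = log λ + σ(t)` for `λ, t > 0` (`√(2λ²t) = λ√(2t)`): the physical window `(1, λ²)`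
is the period window `(σ(1), σ(1) + log λ)` of the similarity time. [folklore] -/
theorem simTimeInv_sq_mul {c t : ℝ} (hc : 0 < c) (ht : 0 < t) :
    simTimeInv (c ^ 2 * t) = simTimeInv t + Real.log c := by
  have hsq : 0 < Real.sqrt (2 * t) := Real.sqrt_pos.2 (by linarith)
  rw [simTimeInv, simTimeInv, show 2 * (c ^ 2 * t) = c ^ 2 * (2 * t) by ring,
    Real.sqrt_mul (sq_nonneg c), Real.sqrt_sq hc.le, Real.log_mul hc.ne' hsq.ne', add_comm]

/-- `σ` is strictly monotone on `(0, ∞)`. [folklore] -/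
theorem simTimeInv_lt_simTimeInv {a b : ℝ} (ha : 0 < a) (hab : a < b) :
    simTimeInv a < simTimeInv b := by
  unfold simTimeInv
  have h2a : 0 < Real.sqrt (2 * a) := Real.sqrt_pos.2 (by linarith)
  exact Real.log_lt_log h2a (Real.sqrt_lt_sqrt (by linarith) (by linarith))

/-- `τ` is strictly monotone. [folklore] -/
theorem simTime_lt_simTime {s s' : ℝ} (h : s < s') : simTime s < simTime s' := by
  unfold simTime
  have := Real.exp_lt_exp.2 (show 2 * s < 2 * s' by linarith)
  linarith

/-- **`Φ⁻¹` of a time window**: `Φ⁻¹((a,b) × ℝ³) = (σ(a), σ(b)) × ℝ³` for `0 < a`, `0 < b`. [folklore] -/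
theorem preimage_simMap_Ioo_prod {a b : ℝ} (ha : 0 < a) (hb : 0 < b) :
    (simMap : ℝ × (EuclideanSpace ℝ (Fin 3)) → ℝ × (EuclideanSpace ℝ (Fin 3))) ⁻¹' (Ioo a b ×ˢ (univ : Set (EuclideanSpace ℝ (Fin 3)))) =
      Ioo (simTimeInv a) (simTimeInv b) ×ˢ (univ : Set (EuclideanSpace ℝ (Fin 3))) := by
  ext ⟨s, y⟩
  simp only [mem_preimage, simMap_apply, mem_prod, mem_Ioo, mem_univ, and_true]
  constructor
  · rintro ⟨h1, h2⟩
    refine ⟨?_, ?_⟩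
    · have := simTimeInv_lt_simTimeInv ha h1
      rwa [simTimeInv_simTime] at this
    · have := simTimeInv_lt_simTimeInv (simTime_pos s) h2
      rwa [simTimeInv_simTime] at this
  · rintro ⟨h1, h2⟩
    refine ⟨?_, ?_⟩
    · have := simTime_lt_simTime h1
      rwa [simTime_simTimeInv ha] at this
    · have := simTime_lt_simTime h2
      rwa [simTime_simTimeInv hb] at this

/-! ### The slice scaling and the energy clause -/

/-- **Slice scaling of the ansatz**: `∫ |v(t, x)|² dx = √(2t) ∫ |u(σ(t), y)|² dy` for `t > 0`
(`dx = (2t)^{3/2} dy` and `|v|² = (2t)⁻¹ |u|²`; [BT1] §4: "`‖v(t) − e^{tΔ}v₀‖²_{L²} ≲ t^{1/2} …`"). [cite: BradshawTsai2017AHP, §4 (proof of Thm 1.2)] -/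
theorem lintegral_enorm_sq_physVelocity (w : ℝ → (EuclideanSpace ℝ (Fin 3)) → (EuclideanSpace ℝ (Fin 3))) {t : ℝ} (ht : 0 < t) :
    ∫⁻ x, ‖physVelocity w t x‖ₑ ^ 2 =
      ENNReal.ofReal (Real.sqrt (2 * t)) * ∫⁻ y, ‖w (simTimeInv t) y‖ₑ ^ 2 := by
  set a : ℝ := Real.sqrt (2 * t) with ha
  have ha0 : 0 < a := Real.sqrt_pos.2 (by linarith)
  have h1 : ∀ x : (EuclideanSpace ℝ (Fin 3)), ‖physVelocity w t x‖ₑ ^ 2 =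
      ENNReal.ofReal (a⁻¹ ^ 2) * (fun x' => ‖w (simTimeInv t) x'‖ₑ ^ 2) ((0 : (EuclideanSpace ℝ (Fin 3))) + a⁻¹ • x) := by
    intro x
    rw [physVelocity_of_pos w ht, enorm_smul, mul_pow, Real.enorm_eq_ofReal (inv_nonneg.2 ha0.le),
      ENNReal.ofReal_pow (inv_nonneg.2 ha0.le), zero_add]
  simp_rw [h1]
  rw [lintegral_const_mul' _ _ ENNReal.ofReal_ne_top,
    lintegral_comp_space_affine (inv_pos.2 ha0) (0 : (EuclideanSpace ℝ (Fin 3))) fun x' => ‖w (simTimeInv t) x'‖ₑ ^ 2,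
    ← mul_assoc, ← ENNReal.ofReal_mul (by positivity), finrank_euclideanSpace_fin]
  congr 2
  field_simp

/-- **The clause `IsAnsatzSolution.energy_sub_heat`** ([BT1] §4: "Note
`v − e^{tΔ}v₀ ∈ L^∞(1,λ²;L²(ℝ³))`", with the bound for every `t`): if `u − U₀ ∈ L^∞(L²)` with
`U₀ = similarityProfile v₀` then `sup_{1 ≤ t ≤ λ²} ∫ |v(t) − e^{tΔ}v₀|² dx ≤ √2 λ sup_s ‖(u − U₀)(s)‖²`. [cite: BradshawTsai2017AHP, §4 (proof of Thm 1.2)] -/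
theorem IsSuitablePeriodicWeakSolution.energy_sub_heat_phys {T : ℝ} {v₀ : (EuclideanSpace ℝ (Fin 3)) → (EuclideanSpace ℝ (Fin 3))}
    {u : ℝ → (EuclideanSpace ℝ (Fin 3)) → (EuclideanSpace ℝ (Fin 3))} {p : ℝ → (EuclideanSpace ℝ (Fin 3)) → ℝ}
    (hS : IsSuitablePeriodicWeakSolution T (similarityProfile v₀) u p) (c : ℝ) :
    ∃ C : ℝ≥0, ∀ t ∈ Icc (1 : ℝ) (c ^ 2),
      ∫⁻ x, ‖physVelocity u t x - UnboundedOperators.heatExtension v₀ t x‖ₑ ^ 2 ≤ C := by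
  obtain ⟨C, hC⟩ := hS.energy
  refine ⟨(Real.sqrt (2 * c ^ 2)).toNNReal * C, fun t ht => ?_⟩
  have ht0 : 0 < t := lt_of_lt_of_le zero_lt_one ht.1
  have h1 : (fun x => ‖physVelocity u t x - UnboundedOperators.heatExtension v₀ t x‖ₑ ^ 2) =
      fun x => ‖physVelocity (fun s y => u s y - similarityProfile v₀ s y) t x‖ₑ ^ 2 := by
    funext x; rw [physVelocity_sub_heatExtension_eq u v₀ ht0]
  rw [h1, lintegral_enorm_sq_physVelocity _ ht0, ENNReal.coe_mul]
  refine mul_le_mul' ?_ (hC _)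
  rw [ENNReal.ofReal]
  exact ENNReal.coe_le_coe.2 (Real.toNNReal_le_toNNReal (Real.sqrt_le_sqrt (by linarith [ht.2])))

/-! ### The pressure class `π ∈ L^{5/3}((1, λ²) × ℝ³)` -/

/-- The weight in the transported pressure integral: `e^{5s} |e^{-2s} q|^{5/3} = e^{5s/3} |q|^{5/3}`. [folklore] -/
theorem simDensity_mul_enorm_physPressure_rpow (p : ℝ → (EuclideanSpace ℝ (Fin 3)) → ℝ) (z : ℝ × (EuclideanSpace ℝ (Fin 3))) :
    (simDensity (EuclideanSpace ℝ (Fin 3)) z : ℝ≥0∞) * ‖physPressure p (simMap z).1 (simMap z).2‖ₑ ^ (5 / 3 : ℝ) =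
      ENNReal.ofReal (Real.exp (5 / 3 * z.1)) * ‖p z.1 z.2‖ₑ ^ (5 / 3 : ℝ) := by
  obtain ⟨s, y⟩ := z
  have h53 : (0 : ℝ) ≤ 5 / 3 := by norm_num
  rw [simMap_apply, physPressure_simMap, enorm_mul,
    ENNReal.mul_rpow_of_nonneg _ _ h53, ← mul_assoc, ← ENNReal.ofReal_coe_nnreal,
    coe_simDensity_three, Real.enorm_eq_ofReal (inv_nonneg.2 (Real.exp_pos _).le),
    ENNReal.ofReal_rpow_of_nonneg (inv_nonneg.2 (Real.exp_pos _).le) h53,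
    ← ENNReal.ofReal_mul (Real.exp_pos _).le]
  congr 2
  simp only
  rw [← Real.exp_neg, ← Real.exp_mul, ← Real.exp_add]
  congr 1
  ring

/-- **The clause `IsAnsatzSolution.pressure_five_thirds`**: `π ∈ L^{5/3}((1,λ²) × ℝ³)` from
`p ∈ L^{5/3}(ℝ³ × [0,T])`, `T = log λ` ([BT1], proof of Thm 2.4: "`p ∈ L^{5/3}(ℝ³ × [0,T])`";
§4: `π(x,t) = p(y,s)/2t`): after the change of variables the integral over `(1,λ²) × ℝ³` is at most
`e^{5σ(λ²)/3}` times the integral of `|p|^{5/3}` over the period window `(σ(1), σ(1)+T) × ℝ³`,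
which equals the one over `(0,T) × ℝ³` by periodicity of `p`. [cite: BradshawTsai2017AHP, §4 (proof of Thm 1.2)] -/
theorem IsSuitablePeriodicWeakSolution.pressure_five_thirds_phys {c : ℝ} (hc : 1 < c)
    {U₀ u : ℝ → (EuclideanSpace ℝ (Fin 3)) → (EuclideanSpace ℝ (Fin 3))} {p : ℝ → (EuclideanSpace ℝ (Fin 3)) → ℝ}
    (hS : IsSuitablePeriodicWeakSolution (Real.log c) U₀ u p)
    (hp : ∫⁻ z in Ioo 0 (Real.log c) ×ˢ (univ : Set (EuclideanSpace ℝ (Fin 3))), ‖p z.1 z.2‖ₑ ^ (5 / 3 : ℝ) < ∞) :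
    ∫⁻ z in Ioo (1 : ℝ) (c ^ 2) ×ˢ (univ : Set (EuclideanSpace ℝ (Fin 3))),
      ‖physPressure p z.1 z.2‖ₑ ^ (5 / 3 : ℝ) < ∞ := by
  have hc0 : 0 < c := zero_lt_one.trans hc
  have hT : 0 < Real.log c := Real.log_pos hc
  have hc2 : 0 < c ^ 2 := by positivity
  set s₁ : ℝ := simTimeInv 1 with hs₁
  have hs₂ : simTimeInv (c ^ 2) = s₁ + Real.log c := by
    rw [hs₁, ← simTimeInv_sq_mul hc0 one_pos, mul_one]
  -- change of variables
  have hA : MeasurableSet (Ioo (1 : ℝ) (c ^ 2) ×ˢ (univ : Set (EuclideanSpace ℝ (Fin 3)))) :=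
    measurableSet_Ioo.prod MeasurableSet.univ
  have hsub : Ioo (1 : ℝ) (c ^ 2) ×ˢ (univ : Set (EuclideanSpace ℝ (Fin 3))) ∩ Ioi (0 : ℝ) ×ˢ (univ : Set (EuclideanSpace ℝ (Fin 3))) =
      Ioo (1 : ℝ) (c ^ 2) ×ˢ (univ : Set (EuclideanSpace ℝ (Fin 3))) :=
    inter_eq_left.2 (prod_mono (fun t ht => lt_trans zero_lt_one ht.1) Subset.rfl)
  have hcov := setLIntegral_inter_slab_eq_simMap
    (fun z : ℝ × (EuclideanSpace ℝ (Fin 3)) => ‖physPressure p z.1 z.2‖ₑ ^ (5 / 3 : ℝ)) hA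
  rw [hsub, preimage_simMap_Ioo_prod one_pos hc2, hs₂] at hcov
  rw [hcov]
  simp_rw [simDensity_mul_enorm_physPressure_rpow]
  -- bound the weight on the window and use periodicity
  set M : ℝ := Real.exp (5 / 3 * (s₁ + Real.log c)) with hM
  have hper : ∀ s y, ‖p (s + Real.log c) y‖ₑ ^ (5 / 3 : ℝ) = ‖p s y‖ₑ ^ (5 / 3 : ℝ) := fun s y => by
    rw [hS.periodic_pressure]
  have hmeas : AEMeasurable (fun z : ℝ × (EuclideanSpace ℝ (Fin 3)) => ‖p z.1 z.2‖ₑ ^ (5 / 3 : ℝ)) volume :=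
    (hS.locallyIntegrable_pressure.aestronglyMeasurable.aemeasurable.enorm.pow_const _)
  calc ∫⁻ z in Ioo s₁ (s₁ + Real.log c) ×ˢ (univ : Set (EuclideanSpace ℝ (Fin 3))),
        ENNReal.ofReal (Real.exp (5 / 3 * z.1)) * ‖p z.1 z.2‖ₑ ^ (5 / 3 : ℝ)
      ≤ ∫⁻ z in Ioo s₁ (s₁ + Real.log c) ×ˢ (univ : Set (EuclideanSpace ℝ (Fin 3))),
          ENNReal.ofReal M * ‖p z.1 z.2‖ₑ ^ (5 / 3 : ℝ) := by
        refine setLIntegral_mono' (measurableSet_Ioo.prod MeasurableSet.univ) fun z hz => ?_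
        refine mul_le_mul_left (ENNReal.ofReal_le_ofReal (Real.exp_le_exp.2 ?_)) _
        have := (mem_prod.1 hz).1.2
        nlinarith
    _ = ENNReal.ofReal M * ∫⁻ z in Ioo 0 (Real.log c) ×ˢ (univ : Set (EuclideanSpace ℝ (Fin 3))),
          ‖p z.1 z.2‖ₑ ^ (5 / 3 : ℝ) := by
        rw [lintegral_const_mul' _ _ ENNReal.ofReal_ne_top,
          setLIntegral_Ioo_prod_eq_of_periodic hmeas hT (fun s y => hper s y) s₁ 0, zero_add]
    _ < ∞ := ENNReal.mul_lt_top ENNReal.ofReal_lt_top hp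

end BradshawTsai2017

end Literature.Analysis.FluidPDE

end
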